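import Literature.MathematicalPhysics.StatisticalMechanics.PeriodicConfigurationSums

/-!
# Crux `ChessboardParticlePlanes.LjBilayerHcp` (stmt-AtomisticToContinuum-6710), line `Sketch` —
# the ROD PICTURE of a normal period-2 stack (regrouping of the site energy by vertical rods)

For a periodic configuration `B` of `ℝ³` with `2c e₃ ∈ B.lattice` (`c ≠ 0`) all of whose points have heights in `cℤ`,
every point is uniquely `q + 2cm e₃` with `m : ℤ` and `q` a BASE POINT (a point of height `0` or `c`); the points are
thus grouped into vertical rods `q + 2cℤ e₃`, and the site energy of a point `x` regroups (Fubini on the absolutely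
summable family) as

  `∑_{y ∈ B.points, y ≠ x} V |x − y| = ∑_{m ≠ 0} V |2cm| + ∑_{rods q ≠ rod of x} ∑_{m ∈ ℤ} V |x − (q + 2cm e₃)|`,

the own-rod self-energy plus the rod–rod kernels.  This is the bookkeeping identity every rod-picture attack on the
crux (two-species planar certificates, star censuses) starts from; with `|x − (q + 2cm e₃)|² = ρ² + (x₂ − q₂ − 2cm)²`
the inner sums are the like / unlike kernels `K₀(ρ) = ∑_k V √(ρ² + (2kc)²)`, `K₁(ρ) = ∑_k V √(ρ² + ((2k+1)c)²)`.
All `[folklore]`.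
-/

noncomputable section

open scoped BigOperators Classical

namespace Summit.AtomisticToContinuum.Crystallization.Theorems.LjBilayerHcpSketch

open Literature.MathematicalPhysics.StatisticalMechanics


/-- Height of a point moved along its rod: `(q + (2cm) e₃)₂ = q₂ + 2cm`. [folklore] -/
theorem rod_height_add (q : (EuclideanSpace ℝ (Fin 3))) (t : ℝ) : (q + t • (EuclideanSpace.single (2 : Fin 3) (1 : ℝ))) 2 = q 2 + t := by
  simp [PiLp.add_apply, PiLp.smul_apply]

/-- Integer multiples of the vertical period are periods. [folklore] -/
theorem rod_period_mem (B : PeriodicConfiguration 3) {c : ℝ} (h2c : (2 * c) • (EuclideanSpace.single (2 : Fin 3) (1 : ℝ)) ∈ B.lattice) (m : ℤ) :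
    (2 * c * (m : ℝ)) • (EuclideanSpace.single (2 : Fin 3) (1 : ℝ)) ∈ B.lattice := by
  have h : (2 * c * (m : ℝ)) • (EuclideanSpace.single (2 : Fin 3) (1 : ℝ)) = (m : ℤ) • ((2 * c) • (EuclideanSpace.single (2 : Fin 3) (1 : ℝ))) := by
    rw [← Int.cast_smul_eq_zsmul ℝ m, smul_smul]; ring_nf
  rw [h]
  exact B.lattice.smul_mem m h2c

/-- Moving a point along its rod stays in the configuration. [folklore] -/
theorem rod_add_mem (B : PeriodicConfiguration 3) {c : ℝ} (h2c : (2 * c) • (EuclideanSpace.single (2 : Fin 3) (1 : ℝ)) ∈ B.lattice) {q : (EuclideanSpace ℝ (Fin 3))}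
    (hq : q ∈ B.points) (m : ℤ) : q + (2 * c * (m : ℝ)) • (EuclideanSpace.single (2 : Fin 3) (1 : ℝ)) ∈ B.points :=
  B.add_mem_points hq (rod_period_mem B h2c m)

/-- **Base-point decomposition**: every point is `q + 2cm e₃` with `q` a point of height `0` or `c`. [folklore] -/
theorem rod_exists_base (B : PeriodicConfiguration 3) {c : ℝ} (h2c : (2 * c) • (EuclideanSpace.single (2 : Fin 3) (1 : ℝ)) ∈ B.lattice)
    (hpts : ∀ x ∈ B.points, ∃ k : ℤ, x 2 = c * (k : ℝ)) {y : (EuclideanSpace ℝ (Fin 3))} (hy : y ∈ B.points) :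
    ∃ q ∈ B.points, (q 2 = 0 ∨ q 2 = c) ∧ ∃ m : ℤ, y = q + (2 * c * (m : ℝ)) • (EuclideanSpace.single (2 : Fin 3) (1 : ℝ)) := by
  obtain ⟨k, hk⟩ := hpts y hy
  refine ⟨y + (2 * c * ((-(k / 2) : ℤ) : ℝ)) • (EuclideanSpace.single (2 : Fin 3) (1 : ℝ)), rod_add_mem B h2c hy _, ?_, k / 2, ?_⟩
  · have hε := Int.emod_two_eq_zero_or_one k
    have hk2' : k = 2 * (k / 2) + k % 2 := by omega
    have hk2 : ((k : ℤ) : ℝ) = 2 * ((k / 2 : ℤ) : ℝ) + ((k % 2 : ℤ) : ℝ) := by exact_mod_cast hk2'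
    rw [rod_height_add, hk, hk2]
    rcases hε with h | h
    · left; rw [h]; push_cast; ring
    · right; rw [h]; push_cast; ring
  · rw [add_assoc, ← add_smul]
    push_cast
    ring_nf
    simp

/-- **Uniqueness of the decomposition**: base points of equal rods coincide. [folklore] -/
theorem rod_base_unique {c : ℝ} (hc : c ≠ 0) {q q' : (EuclideanSpace ℝ (Fin 3))} (hq : q 2 = 0 ∨ q 2 = c) (hq' : q' 2 = 0 ∨ q' 2 = c)
    {m m' : ℤ} (h : q + (2 * c * (m : ℝ)) • (EuclideanSpace.single (2 : Fin 3) (1 : ℝ)) = q' + (2 * c * (m' : ℝ)) • (EuclideanSpace.single (2 : Fin 3) (1 : ℝ))) : q = q' ∧ m = m' := by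
  have hh := congrArg (fun v : (EuclideanSpace ℝ (Fin 3)) => v 2) h
  simp only [rod_height_add] at hh
  have hm : m = m' := by
    rcases hq with h0 | h0 <;> rcases hq' with h1 | h1 <;> rw [h0, h1] at hh
    · have : (m : ℝ) = m' := by
        have : c * ((m : ℝ) - m') = 0 := by linarith
        rcases mul_eq_zero.1 this with h | h
        · exact absurd h hc
        · linarith
      exact_mod_cast this
    · exfalso
      have : c * (2 * ((m : ℝ) - m') - 1) = 0 := by linarith
      rcases mul_eq_zero.1 this with h | h
      · exact hc h
      · have h' : (2 * (m - m') - 1 : ℤ) = 0 := by exact_mod_cast h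
        omega
    · exfalso
      have : c * (2 * ((m : ℝ) - m') + 1) = 0 := by linarith
      rcases mul_eq_zero.1 this with h | h
      · exact hc h
      · have h' : (2 * (m - m') + 1 : ℤ) = 0 := by exact_mod_cast h
        omega
    · have : (m : ℝ) = m' := by
        have : c * ((m : ℝ) - m') = 0 := by linarith
        rcases mul_eq_zero.1 this with h | h
        · exact absurd h hc
        · linarith
      exact_mod_cast this
  subst hm
  exact ⟨add_right_cancel h, rfl⟩

/-- **The rod picture** (regrouping of a site energy by rods).  Let `2c e₃ ∈ B.lattice`, `c ≠ 0`, and all points of `B`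
have heights in `cℤ`.  For a point `x` of `B` and any `V` for which the site sum is summable (e.g. Lennard-Jones,
`rodPicture_tsum_lennardJones`), the sum over the other points of `B` equals the own-rod self-energy
`∑_{m ≠ 0} V |2cm|` plus, over the base points `q` (height `0` or `c`) of the OTHER rods, the full rod sums
`∑_{m ∈ ℤ} V |x − (q + 2cm e₃)|`. [folklore] -/
theorem rodPicture_tsum (B : PeriodicConfiguration 3) {c : ℝ} (hc : c ≠ 0)
    (h2c : (2 * c) • (EuclideanSpace.single (2 : Fin 3) (1 : ℝ)) ∈ B.lattice) (hpts : ∀ x ∈ B.points, ∃ k : ℤ, x 2 = c * (k : ℝ))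
    (V : ℝ → ℝ) {x : (EuclideanSpace ℝ (Fin 3))} (hx : x ∈ B.points)
    (hV : Summable fun y : {y // y ∈ B.points ∧ y ≠ x} => V (dist x y.1)) :
    ∑' y : {y // y ∈ B.points ∧ y ≠ x}, V (dist x y.1) =
      (∑' m : ℤ, if m = 0 then 0 else V |2 * c * (m : ℝ)|) +
      ∑' q : {q // (q ∈ B.points ∧ (q 2 = 0 ∨ q 2 = c)) ∧ ∀ m : ℤ, x ≠ q + (2 * c * (m : ℝ)) • (EuclideanSpace.single (2 : Fin 3) (1 : ℝ))},
        ∑' m : ℤ, V (dist x (q.1 + (2 * c * (m : ℝ)) • (EuclideanSpace.single (2 : Fin 3) (1 : ℝ)))) := by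
  -- the base set and the rod parametrisation `Φ : Q × ℤ ≃ B.points`
  set Q : Set (EuclideanSpace ℝ (Fin 3)) := {q | q ∈ B.points ∧ (q 2 = 0 ∨ q 2 = c)} with hQ
  let Φf : Q × ℤ → {y // y ∈ B.points} := fun p => ⟨p.1.1 + (2 * c * (p.2 : ℝ)) • (EuclideanSpace.single (2 : Fin 3) (1 : ℝ)), rod_add_mem B h2c p.1.2.1 p.2⟩
  have hΦinj : Function.Injective Φf := by
    rintro ⟨⟨q, hq⟩, m⟩ ⟨⟨q', hq'⟩, m'⟩ h
    have h' : q + (2 * c * (m : ℝ)) • (EuclideanSpace.single (2 : Fin 3) (1 : ℝ)) = q' + (2 * c * (m' : ℝ)) • (EuclideanSpace.single (2 : Fin 3) (1 : ℝ)) := congrArg Subtype.val h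
    obtain ⟨rfl, rfl⟩ := rod_base_unique hc hq.2 hq'.2 h'
    rfl
  have hΦsurj : Function.Surjective Φf := by
    rintro ⟨y, hy⟩
    obtain ⟨q, hq, hq0, m, rfl⟩ := rod_exists_base B h2c hpts hy
    exact ⟨(⟨q, hq, hq0⟩, m), rfl⟩
  let Φ : Q × ℤ ≃ {y // y ∈ B.points} := Equiv.ofBijective Φf ⟨hΦinj, hΦsurj⟩
  have hΦ : ∀ p : Q × ℤ, (Φ p).1 = p.1.1 + (2 * c * (p.2 : ℝ)) • (EuclideanSpace.single (2 : Fin 3) (1 : ℝ)) := fun p => rfl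
  -- the base point of `x`
  obtain ⟨qx, hqx, hqx0, mx, hxe⟩ := rod_exists_base B h2c hpts hx
  -- the zero-extended summand
  let f : (EuclideanSpace ℝ (Fin 3)) → ℝ := fun y => if y = x then 0 else V (dist x y)
  -- (1) the site sum is the sum of `f` over all points
  have h1 : ∑' y : {y // y ∈ B.points ∧ y ≠ x}, V (dist x y.1) = ∑' y : {y // y ∈ B.points}, f y.1 := by
    have hA := tsum_subtype ({y | y ∈ B.points ∧ y ≠ x} : Set (EuclideanSpace ℝ (Fin 3))) (fun y => V (dist x y))
    have hB := tsum_subtype (B.points : Set (EuclideanSpace ℝ (Fin 3))) f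
    change ∑' y : ({y | y ∈ B.points ∧ y ≠ x} : Set (EuclideanSpace ℝ (Fin 3))), V (dist x y.1) = ∑' y : (B.points : Set (EuclideanSpace ℝ (Fin 3))), f y.1
    rw [hA, hB]
    refine tsum_congr fun y => ?_
    by_cases hyx : y = x
    · subst hyx
      simp [Set.indicator, f]
    · by_cases hy : y ∈ B.points
      · simp [Set.indicator, f, hy, hyx]
      · simp [Set.indicator, f, hy, hyx]
  -- summability of `f` over all points, transported to `Q × ℤ`
  have hfS : Summable fun y : {y // y ∈ B.points} => f y.1 := by
    have hV' : Summable (({y | y ∈ B.points ∧ y ≠ x} : Set (EuclideanSpace ℝ (Fin 3))).indicator fun y => V (dist x y)) :=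
      (summable_subtype_iff_indicator (s := ({y | y ∈ B.points ∧ y ≠ x} : Set (EuclideanSpace ℝ (Fin 3)))) (f := fun y => V (dist x y))).1 hV
    have : Summable ((B.points : Set (EuclideanSpace ℝ (Fin 3))).indicator f) := by
      refine hV'.congr fun y => ?_
      by_cases hyx : y = x
      · subst hyx; simp [Set.indicator, f]
      · by_cases hy : y ∈ B.points
        · simp [Set.indicator, f, hy, hyx]
        · simp [Set.indicator, f, hy, hyx]
    exact (summable_subtype_iff_indicator (s := (B.points : Set (EuclideanSpace ℝ (Fin 3)))) (f := f)).2 this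
  let F : Q × ℤ → ℝ := fun p => f (Φ p).1
  have hF : Summable F := (Φ.summable_iff (f := fun y : {y // y ∈ B.points} => f y.1)).2 hfS
  -- (2) transport and Fubini
  have h2 : ∑' y : {y // y ∈ B.points}, f y.1 = ∑' q : Q, ∑' m : ℤ, F (q, m) := by
    rw [← Φ.tsum_eq (fun y : {y // y ∈ B.points} => f y.1)]
    exact hF.tsum_prod
  -- (3) split off the rod of `x`
  let G : Q → ℝ := fun q => ∑' m : ℤ, F (q, m)
  have hG : Summable G := hF.prod
  have h3 : ∑' q : Q, G q = G ⟨qx, hqx, hqx0⟩ + ∑' q : Q, ite (q = ⟨qx, hqx, hqx0⟩) 0 (G q) :=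
    hG.tsum_eq_add_tsum_ite ⟨qx, hqx, hqx0⟩
  -- (4) the own rod
  have h4 : G ⟨qx, hqx, hqx0⟩ = ∑' m : ℤ, if m = 0 then 0 else V |2 * c * (m : ℝ)| := by
    have key : ∀ m : ℤ, F (⟨qx, hqx, hqx0⟩, m) =
        (fun n : ℤ => if n = 0 then 0 else V |2 * c * (n : ℝ)|) (m - mx) := by
      intro m
      simp only [F, f, hΦ]
      by_cases hm : m = mx
      · subst hm
        simp [hxe]
      · have hne : qx + (2 * c * (m : ℝ)) • (EuclideanSpace.single (2 : Fin 3) (1 : ℝ)) ≠ x := by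
          intro h
          rw [hxe] at h
          exact hm (rod_base_unique hc hqx0 hqx0 h).2
        have hsub : m - mx ≠ 0 := sub_ne_zero.2 hm
        rw [if_neg hne, if_neg hsub]
        congr 1
        rw [hxe, dist_eq_norm]
        have : qx + (2 * c * (mx : ℝ)) • (EuclideanSpace.single (2 : Fin 3) (1 : ℝ)) - (qx + (2 * c * (m : ℝ)) • (EuclideanSpace.single (2 : Fin 3) (1 : ℝ))) = (2 * c * (mx : ℝ) - 2 * c * (m : ℝ)) • (EuclideanSpace.single (2 : Fin 3) (1 : ℝ)) := by
          rw [sub_smul]; abel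
        have hnorm : ‖(EuclideanSpace.single (2 : Fin 3) (1 : ℝ) : EuclideanSpace ℝ (Fin 3))‖ = 1 := by simp
        rw [this, norm_smul, hnorm, mul_one, Real.norm_eq_abs]
        push_cast
        rw [show 2 * c * (mx : ℝ) - 2 * c * m = -(2 * c * (m - mx)) by ring, abs_neg]
    simp only [G, key]
    exact (Equiv.subRight mx).tsum_eq (fun n : ℤ => if n = 0 then 0 else V |2 * c * (n : ℝ)|)
  -- (5) the other rods
  have h5 : ∑' q : Q, ite (q = ⟨qx, hqx, hqx0⟩) 0 (G q) =
      ∑' q : {q // (q ∈ B.points ∧ (q 2 = 0 ∨ q 2 = c)) ∧ ∀ m : ℤ, x ≠ q + (2 * c * (m : ℝ)) • (EuclideanSpace.single (2 : Fin 3) (1 : ℝ))},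
        ∑' m : ℤ, V (dist x (q.1 + (2 * c * (m : ℝ)) • (EuclideanSpace.single (2 : Fin 3) (1 : ℝ)))) := by
    -- both sides as sums over `(EuclideanSpace ℝ (Fin 3))` of indicator functions
    let H : (EuclideanSpace ℝ (Fin 3)) → ℝ := fun q => ∑' m : ℤ, V (dist x (q + (2 * c * (m : ℝ)) • (EuclideanSpace.single (2 : Fin 3) (1 : ℝ))))
    let G' : (EuclideanSpace ℝ (Fin 3)) → ℝ := fun q => ∑' m : ℤ, f (q + (2 * c * (m : ℝ)) • (EuclideanSpace.single (2 : Fin 3) (1 : ℝ)))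
    set R : Set (EuclideanSpace ℝ (Fin 3)) := {q | (q ∈ B.points ∧ (q 2 = 0 ∨ q 2 = c)) ∧ ∀ m : ℤ, x ≠ q + (2 * c * (m : ℝ)) • (EuclideanSpace.single (2 : Fin 3) (1 : ℝ))} with hR
    have hA : ∑' q : Q, ite (q = ⟨qx, hqx, hqx0⟩) 0 (G q) = ∑' q : (EuclideanSpace ℝ (Fin 3)), Q.indicator (fun q => ite (q = qx) 0 (G' q)) q := by
      rw [← tsum_subtype Q (fun q => ite (q = qx) 0 (G' q))]
      refine tsum_congr fun q => ?_
      have : (q = ⟨qx, hqx, hqx0⟩) ↔ (q.1 = qx) := by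
        constructor
        · intro h; rw [h]
        · intro h; exact Subtype.ext h
      by_cases hq : q.1 = qx
      · rw [if_pos (this.2 hq), if_pos hq]
      · rw [if_neg (fun h => hq (this.1 h)), if_neg hq]
        rfl
    have hB : (∑' q : R, H q.1) = ∑' q : (EuclideanSpace ℝ (Fin 3)), R.indicator H q := tsum_subtype R H
    change _ = ∑' q : R, H q.1
    rw [hA, hB]
    refine tsum_congr fun q => ?_
    by_cases hqQ : q ∈ Q
    · by_cases hq : q = qx
      · -- the rod of `x`: absent on the right
        subst hq
        have hnot : q ∉ R := fun h => h.2 mx hxe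
        simp [Set.indicator, hqQ, hnot]
      · -- another rod: present on both sides, and `f = V ∘ dist x` along it
        have hoff : ∀ m : ℤ, x ≠ q + (2 * c * (m : ℝ)) • (EuclideanSpace.single (2 : Fin 3) (1 : ℝ)) := by
          intro m h
          rw [hxe] at h
          exact hq (rod_base_unique hc hqQ.2 hqx0 h.symm).1
        have hin : q ∈ R := ⟨hqQ, hoff⟩
        simp only [Set.indicator, hqQ, hin, if_true, if_neg hq]
        refine tsum_congr fun m => ?_
        simp only [f]
        rw [if_neg (fun h => hoff m h.symm)]
    · have hnot : q ∉ R := fun h => hqQ h.1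
      simp [Set.indicator, hqQ, hnot]
  -- assemble
  rw [h1, h2]
  change ∑' q : Q, G q = _
  rw [h3, h4, h5]

/-- The rod picture for the Lennard-Jones site energy of any point of a normal period-2 stack (summability is automatic
in `ℝ³`). [folklore] -/
theorem rodPicture_tsum_lennardJones : ∀ (B : PeriodicConfiguration 3) (c : ℝ), c ≠ 0 → (2 * c) • EuclideanSpace.single (2 : Fin 3) (1 : ℝ) ∈ B.lattice → (∀ x ∈ B.points, ∃ k : ℤ, x 2 = c * (k : ℝ)) → ∀ x ∈ B.points, ∑' y : {y // y ∈ B.points ∧ y ≠ x}, lennardJones (dist x y.1) = (∑' m : ℤ, if m = 0 then 0 else lennardJones |2 * c * (m : ℝ)|) + ∑' q : {q // (q ∈ B.points ∧ (q 2 = 0 ∨ q 2 = c)) ∧ ∀ m : ℤ, x ≠ q + (2 * c * (m : ℝ)) • EuclideanSpace.single (2 : Fin 3) (1 : ℝ)}, ∑' m : ℤ, lennardJones (dist x (q.1 + (2 * c * (m : ℝ)) • EuclideanSpace.single (2 : Fin 3) (1 : ℝ))) :=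
  fun B _c hc h2c hpts _x hx => rodPicture_tsum B hc h2c hpts lennardJones hx (B.summable_lennardJones_dist_three _)


/-! ## Planar form of the rod sums: the like / unlike kernels -/

/-- Pythagoras along a rod: `|x − (q + t e₃)|² = ρ² + (x₂ − q₂ − t)²` with `ρ² = (x₀ − q₀)² + (x₁ − q₁)²` the squared
planar distance. [folklore] -/
theorem rod_dist_sq (x q : (EuclideanSpace ℝ (Fin 3))) (t : ℝ) :
    dist x (q + t • (EuclideanSpace.single (2 : Fin 3) (1 : ℝ))) ^ 2 = ((x 0 - q 0) ^ 2 + (x 1 - q 1) ^ 2) + (x 2 - q 2 - t) ^ 2 := by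
  rw [EuclideanSpace.dist_eq, Real.sq_sqrt (Finset.sum_nonneg fun i _ => sq_nonneg _), Fin.sum_univ_three]
  simp [PiLp.add_apply, PiLp.smul_apply, Real.dist_eq, sq_abs, sub_sub]

/-- The distance along a rod as a square root. [folklore] -/
theorem rod_dist_eq_sqrt (x q : (EuclideanSpace ℝ (Fin 3))) (t : ℝ) :
    dist x (q + t • (EuclideanSpace.single (2 : Fin 3) (1 : ℝ))) = √(((x 0 - q 0) ^ 2 + (x 1 - q 1) ^ 2) + (x 2 - q 2 - t) ^ 2) := by
  rw [← rod_dist_sq, Real.sqrt_sq dist_nonneg]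

/-- **Like kernel.**  For two points of EQUAL height the rod sum is `K₀(ρ) = ∑_k V √(ρ² + (2ck)²)`. [folklore] -/
theorem rod_tsum_same_height (V : ℝ → ℝ) (c : ℝ) {x q : (EuclideanSpace ℝ (Fin 3))} (h : x 2 = q 2) :
    ∑' m : ℤ, V (dist x (q + (2 * c * (m : ℝ)) • (EuclideanSpace.single (2 : Fin 3) (1 : ℝ)))) =
      ∑' k : ℤ, V (√(((x 0 - q 0) ^ 2 + (x 1 - q 1) ^ 2) + (2 * c * (k : ℝ)) ^ 2)) := by
  rw [← (Equiv.neg ℤ).tsum_eq (fun k : ℤ => V (√(((x 0 - q 0) ^ 2 + (x 1 - q 1) ^ 2) + (2 * c * (k : ℝ)) ^ 2)))]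
  refine tsum_congr fun m => ?_
  rw [rod_dist_eq_sqrt, h, sub_self, zero_sub, Equiv.neg_apply]
  push_cast
  ring_nf

/-- **Unlike kernel.**  For two points whose heights differ by `± c` the rod sum is `K₁(ρ) = ∑_k V √(ρ² + ((2k+1)c)²)`.
[folklore] -/
theorem rod_tsum_height_diff (V : ℝ → ℝ) (c : ℝ) {x q : (EuclideanSpace ℝ (Fin 3))} (h : x 2 - q 2 = c ∨ x 2 - q 2 = -c) :
    ∑' m : ℤ, V (dist x (q + (2 * c * (m : ℝ)) • (EuclideanSpace.single (2 : Fin 3) (1 : ℝ)))) =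
      ∑' k : ℤ, V (√(((x 0 - q 0) ^ 2 + (x 1 - q 1) ^ 2) + ((2 * (k : ℝ) + 1) * c) ^ 2)) := by
  rcases h with h | h
  · -- `x₂ − q₂ = c`: `(c − 2cm)² = ((2(−m) + 1)c)²`, reindex `k = −m`
    rw [← (Equiv.neg ℤ).tsum_eq (fun k : ℤ => V (√(((x 0 - q 0) ^ 2 + (x 1 - q 1) ^ 2) + ((2 * (k : ℝ) + 1) * c) ^ 2)))]
    refine tsum_congr fun m => ?_
    rw [rod_dist_eq_sqrt, h, Equiv.neg_apply]
    push_cast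
    ring_nf
  · -- `x₂ − q₂ = −c`: `(−c − 2cm)² = ((2m + 1)c)²`
    refine tsum_congr fun m => ?_
    rw [rod_dist_eq_sqrt, h]
    ring_nf

end Summit.AtomisticToContinuum.Crystallization.Theorems.LjBilayerHcpSketch

end
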